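import Summits.Ventures.PercRepro.S1ChainCoNullCellsT
import Summits.Ventures.PercRepro.S1TriangleCoverNullity
import Summits.Ventures.PercRepro.S1ChainCq

/-!
# PercRepro — THE CHAIN CONSUMER WITH THE PER-`t` CAP AND THE PRUNED `(B)`-LINES (p2, gen 26; SUBCLAIM-S1 §6.10)

`rls_of_ladder_case_chain_conull_capT` with the vacuous `(B)`-lines removed: a `(B, i, u)`-line has EVERY one of the
`t` triangles inside the chain union `Sₙ` of `u` points, so `t ≤ cq3 (ν(Sₙ))` (the triangle table on the `e`-free
restriction `N ↾ Sₙ`) and `ν(Sₙ) ≤ u − 2` (`Sₙ` contains a triangle, so it has rank `≥ 2`) — the line is only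
required when `t ≤ cq3 (u − 2)`. At `(9, 10)` this is exactly what the unpruned consumer lacks at `t = 6 … 11`
(its binding lines were `(B, 1, 3)`: ten triangles inside three points).

* `cq3_mono` — the triangle table is monotone;
* `ncard_triangles_le_cq3_of_subset` — `t ≤ cq3 ν` when every triangle lies in a set of nullity `ν`;
* `two_le_eRk_of_triangle_subset` — a set containing a triangle has rank `≥ 2`;
* **`rls_of_ladder_case_chain_conull_capTP`** — one ladder case with the per-`t` cap, `(B)`-lines pruned.
Axioms: standard.
-/

open scoped Matroid

namespace PercRepro

namespace S1

open Set

variable {α : Type}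

/-- **The triangle table is monotone**: `cq3 a ≤ cq3 b` for `a ≤ b`. -/
theorem cq3_mono {a b : ℕ} (h : a ≤ b) : TriangleCap.cq3 a ≤ TriangleCap.cq3 b := by
  have htab : ∀ b < 30, ∀ a ≤ b, TriangleCap.cq3 a ≤ TriangleCap.cq3 b := by decide +kernel
  have hbig : ∀ d, 30 ≤ d → TriangleCap.cq3 d = d * (d + 1) / 2 := by
    intro d hd
    unfold TriangleCap.cq3 cq
    rw [if_neg (by omega), if_neg (by omega)]
  rcases Nat.lt_or_ge b 30 with hb | hb
  · exact htab b hb a h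
  rcases Nat.lt_or_ge a 30 with ha | ha
  · have h1 : TriangleCap.cq3 a ≤ TriangleCap.cq3 29 := htab 29 (by norm_num) a (by omega)
    have h2 : TriangleCap.cq3 29 = 236 := by decide
    have h3 : 465 ≤ b * (b + 1) / 2 := by
      have : 30 * 31 ≤ b * (b + 1) := Nat.mul_le_mul hb (by omega)
      omega
    rw [hbig b hb]
    omega
  · rw [hbig a ha, hbig b hb]
    exact Nat.div_le_div_right (Nat.mul_le_mul h (by omega))

/-- A set containing a triangle of an `e`-free matroid has rank `≥ 2`. -/
theorem two_le_eRk_of_triangle_subset (N : Matroid α) [N.Finite]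
    (hfree : ∀ e ∈ N.E, ∃ A ⊆ N.E \ {e}, e ∉ N.closure A ∧ e ∉ N.closure ((N.E \ {e}) \ A))
    {S C : Set α} (hC : N.IsCircuit C) (h3 : C.ncard = 3) (hCS : C ⊆ S) :
    (2 : ℕ∞) ≤ N.eRk S := by
  obtain ⟨e, f, g, hef, -, -, rfl⟩ := Set.ncard_eq_three.1 h3
  have he : e ∈ N.E := hC.subset_ground (by simp)
  have hf : f ∈ N.E := hC.subset_ground (by simp)
  have h2 : (2 : ℕ∞) ≤ N.eRk {e, f} :=
    ThmN.two_le_eRk_of_two_le_ncard_of_free N hfree (pair_subset he hf) (by rw [ncard_pair hef])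
  exact h2.trans (N.eRk_mono (fun x hx => hCS (by simp only [Set.mem_insert_iff, Set.mem_singleton_iff] at hx; rcases hx with rfl | rfl <;> simp)))

/-- **The triangle table on a part**: if every triangle of an `e`-free matroid lies inside `S` of nullity `ν`,
then `s₃ ≤ cq3 ν`. -/
theorem ncard_triangles_le_cq3_of_subset (N : Matroid α) [N.Finite]
    (hfree : ∀ e ∈ N.E, ∃ A ⊆ N.E \ {e}, e ∉ N.closure A ∧ e ∉ N.closure ((N.E \ {e}) \ A))
    {S : Set α} (hS : S ⊆ N.E) (hall : ∀ C, N.IsCircuit C → C.ncard = 3 → C ⊆ S)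
    {ν : ℕ} (hν : S.encard = N.eRk S + (ν : ℕ∞)) :
    {C : Set α | N.IsCircuit C ∧ C.ncard = 3}.ncard ≤ TriangleCap.cq3 ν := by
  have hSfin : S.Finite := N.ground_finite.subset hS
  haveI : (N ↾ S).Finite := N.restrict_finite hSfin
  have hfree' := hfree_restrict N hfree hS
  have hd' : (N ↾ S).E.encard = (N ↾ S).eRank + (ν : ℕ∞) := by
    rw [Matroid.restrict_ground_eq, Matroid.eRank_restrict]; exact hν
  have htri : {C : Set α | (N ↾ S).IsCircuit C ∧ C.ncard = 3} = {C : Set α | N.IsCircuit C ∧ C.ncard = 3} := by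
    ext C
    simp only [Set.mem_setOf_eq, Matroid.restrict_isCircuit_iff hS]
    constructor
    · rintro ⟨⟨hC, -⟩, h3⟩; exact ⟨hC, h3⟩
    · rintro ⟨hC, h3⟩; exact ⟨⟨hC, hall C hC h3⟩, h3⟩
  have := TriangleCap.core_ncard_triangles_le_cq3 (N ↾ S) hfree' hd'
  rwa [htri] at this


/-- **ONE LADDER CASE BY THE CHAIN LEVERS WITH THE PER-PAIR KILL, THE CO-NULLITY CREDIT AND THE PER-`t` CAP,
`(B)`-LINES PRUNED**: as `rls_of_ladder_case_chain_conull_capT`, but a `(B, i, u)`-line (the stopped chain of `i`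
triangles with union `u` and every triangle inside it) is required only when `t ≤ cq3 (u − 2)`. -/
theorem rls_of_ladder_case_chain_conull_capTP (M : Matroid α) [M.Finite] {p0 p c d n : ℕ} (hp0 : p0 = p + c) (hnd : n = p0 + d)
    (hR : M.eRank = (p0 : ℕ∞)) (hn : M.E.ncard = n)
    (hfree : ∀ e ∈ M.E, ∃ A ⊆ M.E \ {e}, e ∉ M.closure A ∧ e ∉ M.closure ((M.E \ {e}) \ A))
    (hc : M.coloops.ncard = c) (hp : 6 ≤ p) (hd4 : 4 ≤ d) {P S5 : ℕ} (S : ℕ → ℕ)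
    (hP : min ((p + d) * TriangleCap.cq3 (d - 1) / (p + d - 3)) (TriangleCap.cq3 d) ≤ P)
    (hScap : ∀ (N : Matroid α) [N.Finite],
      (∀ e ∈ N.E, ∃ A ⊆ N.E \ {e}, e ∉ N.closure A ∧ e ∉ N.closure ((N.E \ {e}) \ A)) →
      N.E.encard = N.eRank + ((d : ℕ) : ℕ∞) → N.E.ncard = p + d → N.coloops = ∅ →
      ∀ t, {C : Set α | N.IsCircuit C ∧ C.ncard = 3}.ncard = t →
      {C : Set α | N.IsCircuit C ∧ C.ncard = 4}.ncard ≤ S t)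
    (hS5 : (p + d) * avgChain5b (d - 1) / (p + d - 5) ≤ S5)
    (rr : ℕ → ℕ)
    (hrr : ∀ t ∈ Finset.Icc 1 P, 1 ≤ rr t ∧ TriangleCap.cq3 (rr t - 1) < t ∧
      ∀ ν < rr t, TriangleCap.cq3 ν ≤ TriangleCap.cq3 (rr t - 1))
    (hzero : ladderOK p0 p d 0 (S 0) S5 (∑ j ∈ Finset.range c, 2 ^ (n - 1 - j))
      (∑ j ∈ Finset.range c, w3plus (n - 1 - j)) = true)
    (hokA : ∀ t ∈ Finset.Icc 1 P, ∀ u ∈ Finset.Icc 3 (3 * rr t),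
      killnullOK p0 p d t (S t) S5 ((∑ j ∈ Finset.range c, 2 ^ (n - 1 - j)) +
          (rr t * (p + d - 3).choose (p - 3) + zcred (p + d) p (p + d - u) (d + 1 - rr t)))
        ((∑ j ∈ Finset.range c, w3plus (n - 1 - j)) + killPairB (rr t) u (p + d) p)
        (exclXc (p + d) (p + d - u) (d + 1 - rr t) (S t) t (rr t)) = true)
    (hokB : ∀ t ∈ Finset.Icc 1 P, ∀ i ∈ Finset.Icc 1 (rr t - 1), ∀ u ∈ Finset.Icc 3 (3 * i),
      t ≤ TriangleCap.cq3 (u - 2) →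
      killnullOK p0 p d t (S t) S5 ((∑ j ∈ Finset.range c, 2 ^ (n - 1 - j)) +
          (i * (p + d - 3).choose (p - 3) + zcred (p + d) p (p + d - u) (d + 1 - rr t)))
        ((∑ j ∈ Finset.range c, w3plus (n - 1 - j)) + killPairB i u (p + d) p)
        (exclXc (p + d) (p + d - u) (d + 1 - rr t) (S t) t t) = true) :
    ThmN.RLS M p0 4 := by
  subst hp0
  have hR' : M.eRank = ((p + c : ℕ) : ℕ∞) := hR
  obtain ⟨N, hNfin, hNR, hNn, hNcol, hNfree, hNtop, hNmid⟩ := ladder_exact c M p hR' (by omega) (by omega) hfree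
  have hNn' : N.E.ncard = p + d := by omega
  have hNcol0 : N.coloops = ∅ := by
    have h0 : N.coloops.ncard = 0 := by omega
    exact (Set.ncard_eq_zero (N.ground_finite.subset N.coloops_subset_ground)).1 h0
  have hNd : N.E.encard = N.eRank + ((d - 1 + 1 : ℕ) : ℕ∞) := by
    rw [hNR, ← N.ground_finite.cast_ncard_eq, hNn', show d - 1 + 1 = d by omega]
    push_cast
    ring
  have hNd' : N.E.encard = N.eRank + (((d - 1 : ℕ) : ℕ∞) + 1) := by rw [hNd, Nat.cast_succ]
  have hNdd : N.E.encard = N.eRank + ((d : ℕ) : ℕ∞) := by rw [hNd, show d - 1 + 1 = d by omega]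
  have hP' : {C : Set α | N.IsCircuit C ∧ C.ncard = 3}.ncard ≤ P :=
    (le_min (ncard_triangles_le_of_coloopFree N hNfree hNd hNcol0 hNn' (by omega))
      (TriangleCap.core_ncard_triangles_le_cq3 N hNfree hNdd)).trans hP
  have hS' := hScap N hNfree hNdd hNn' hNcol0 _ rfl
  have hS5' := (ncard_fiveCircuits_le_of_coloopFree N hNfree hNd' hNcol0 hNn' (by omega)).trans hS5
  -- the core facts of `N`
  have hL : ∀ e ∈ N.E, ¬ N.IsLoop e := ThmN.not_isLoop_of_free N hNfree
  have hs : ∀ e ∈ N.E, ∀ f ∈ N.E, e ≠ f → N.eRk {e, f} = 2 := by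
    intro e he f hf hef
    have h2 : (2 : ℕ∞) ≤ N.eRk {e, f} :=
      ThmN.two_le_eRk_of_two_le_ncard_of_free N hNfree (pair_subset he hf) (by rw [ncard_pair hef])
    have h3 : N.eRk {e, f} ≤ 2 := by
      have := N.eRk_le_encard {e, f}
      rwa [encard_pair hef] at this
    exact le_antisymm h3 h2
  have hcirc : ∀ C, N.IsCircuit C → 3 ≤ C.encard := ThmN.three_le_encard_of_circuit N hL hs
  have hC1 : ∀ L ⊆ N.E, N.eRk L = 2 → L.ncard ≤ 3 := by
    intro L hL' hr
    have := ThmN.ncard_add_one_le_two_pow_of_eRk_le N hL hNfree 2 L hL' hr.le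
    omega
  set t := {C : Set α | N.IsCircuit C ∧ C.ncard = 3}.ncard with ht
  set St := S t with hSt
  set A := ∑ j ∈ Finset.range c, 2 ^ (n - 1 - j) with hA
  set B := ∑ j ∈ Finset.range c, w3plus (n - 1 - j) with hB
  -- a kernel line applied to a triangle family `𝒯'` with union of size `u`, an exclusion `X` and a credit `Zc`
  have hline : ∀ (𝒯' : Finset (Set α)), (∀ C ∈ 𝒯', N.IsCircuit C ∧ C.ncard = 3) → ∀ u, (⋃ C ∈ 𝒯', C).ncard = u →
      ∀ (Sn : Set α), Sn ⊆ N.E → ∀ (r kk X : ℕ), N.eRk Sn + (r : ℕ∞) ≤ (Sn.ncard : ℕ∞) → d + 1 ≤ kk + r →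
      X ≤ {B : Set α | B ⊆ N.E ∧ B.ncard = 4 ∧ N.eRk B = 4 ∧ kk ≤ (B \ Sn).ncard}.ncard →
      ∀ (Zc : ℕ) (𝒵 : Finset (Set α)), (∀ A ∈ 𝒵, A ⊆ N.E ∧ p + 1 ≤ A.ncard ∧ N.eRk A < (p : ℕ∞)) → 𝒵.card = Zc →
      killnullOK (p + c) p d t St S5 (A + (𝒯'.card * (p + d - 3).choose (p - 3) + Zc))
        (B + killPairB 𝒯'.card u (p + d) p) X = true →
      phiK (p + c) 4 * (Matroid.topCount N p 4 : ℚ) + B ≤ (Matroid.midCount N p 4 : ℚ) + A := by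
    intro 𝒯' h𝒯' u hu Sn hSn r kk X hν hkk hX Zc 𝒵 h𝒵 hZc hok
    refine weighted_of_killnullOK_conull N (p + c) p d t St S5 A B X hd4 hNR hNn' hNfree le_rfl hS' hS5' hp
      (by omega) 𝒯' h𝒯' hu 𝒵 h𝒵 hSn hν hkk hX ?_
    rw [hZc]
    exact hok
  -- the weighted inequality on `N`
  have hw : phiK (p + c) 4 * (Matroid.topCount N p 4 : ℚ) + B ≤ (Matroid.midCount N p 4 : ℚ) + A := by
    rcases Nat.eq_zero_or_pos t with h0 | hpos
    · have hS0 : {C : Set α | N.IsCircuit C ∧ C.ncard = 4}.ncard ≤ S 0 := by rw [← h0]; exact hS'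
      exact weighted_of_ladderOK N (p + c) p d 0 (S 0) S5 A B hd4 hNR hNn' hNfree (by rw [← ht, h0]) hS0 hS5'
        (by omega) (by omega) hzero
    · have htI : t ∈ Finset.Icc 1 P := Finset.mem_Icc.2 ⟨hpos, hP'⟩
      obtain ⟨hr1, hcq, hmono⟩ := hrr t htI
      set r := rr t with hr
      have hcq' : TriangleCap.cq3 (r - 1) < (ThmN.triangles N).ncard := hcq
      obtain ⟨Sn, hSnE, 𝒯', h𝒯'tri, h𝒯'un, hu3r, hSnν, hcase⟩ := exists_chain_family N hNfree r hcq' hmono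
      have hSnfin : Sn.Finite := N.ground_finite.subset hSnE
      have hsubS : ∀ C ∈ 𝒯', C ⊆ Sn := fun C hC => by
        rw [← h𝒯'un]; exact fun x hx => Set.mem_iUnion₂.2 ⟨C, hC, hx⟩
      -- `𝒯'` is nonempty (`Sn` has nullity `≥ r ≥ 1`), so `|Sn| ≥ 3`
      have hne : 𝒯'.Nonempty := by
        by_contra h0
        rw [Finset.not_nonempty_iff_eq_empty] at h0
        rw [h0] at h𝒯'un
        simp only [Finset.notMem_empty, Set.iUnion_of_empty, Set.iUnion_empty] at h𝒯'un
        rw [← h𝒯'un, Set.ncard_empty, Matroid.eRk_empty, zero_add] at hSnν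
        have : r ≤ 0 := by exact_mod_cast hSnν
        omega
      have hSn3 : 3 ≤ Sn.ncard := by
        obtain ⟨C, hC⟩ := hne
        have := Set.ncard_le_ncard (hsubS C hC) hSnfin
        rw [(h𝒯'tri C hC).2] at this
        exact this
      set u := Sn.ncard with hu
      set m := (N.E \ Sn).ncard with hm
      have hmE : m + u = N.E.ncard := Set.ncard_sdiff_add_ncard_of_subset hSnE N.ground_finite
      have hmu : m = p + d - u := by omega
      have hu' : (⋃ C ∈ 𝒯', C).ncard = u := by rw [h𝒯'un]
      set k := d + 1 - r with hk
      -- the co-nullity family and its credit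
      have hZ : ∃ 𝒵 : Finset (Set α), (∀ A ∈ 𝒵, A ⊆ N.E ∧ p + 1 ≤ A.ncard ∧ N.eRk A < (p : ℕ∞)) ∧
          𝒵.card = zcred (p + d) p m k := by
        by_cases hkm : k ≤ m
        · obtain ⟨𝒵, h𝒵, h𝒵card⟩ := exists_conull_family N hNn' hSnE hSnν (by omega) hkm
          refine ⟨𝒵, h𝒵, ?_⟩
          rw [h𝒵card]
          unfold zcred
          rw [if_pos hkm]
        · refine ⟨∅, fun A hA => absurd hA (Finset.notMem_empty A), ?_⟩
          unfold zcred
          rw [if_neg hkm, Finset.card_empty]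
      obtain ⟨𝒵, h𝒵, hZc⟩ := hZ
      -- the exclusion credit is honest, with `o` outside triangles
      have hXgen : ∀ o, o ≤ t → {C : Set α | N.IsCircuit C ∧ C.ncard = 3 ∧ ¬ C ⊆ Sn}.ncard ≤ o →
          exclXc (p + d) m k St t (t - o) ≤
            {B : Set α | B ⊆ N.E ∧ B.ncard = 4 ∧ N.eRk B = 4 ∧ k ≤ (B \ Sn).ncard}.ncard := by
        intro o hot ho
        unfold exclXc
        split_ifs with hk24 hm2
        · obtain ⟨hm2', hk2'⟩ := hm2
          have h := excl_ge_two N hcirc hC1 (S := Sn) (by rw [← hm]; exact hm2')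
          rw [hNn'] at h
          have hexcl : exclCount (p + d) 2 2 = (p + d - 2).choose 2 := by
            unfold exclCount
            rw [show (2 : ℕ).choose 4 = 0 from Nat.choose_eq_zero_of_lt (by norm_num)]
            simp
          rw [hexcl, hk2']
          have h2 : {C : Set α | N.IsCircuit C ∧ C.ncard = 3 ∧ ¬ C ⊆ Sn}.ncard ≤ t - (t - o) := by omega
          omega
        · have h := excl_ge_all N hcirc Sn hk24.1 hk24.2
          rw [hNn', ← hm] at h
          unfold exclX
          have h2 : {C : Set α | N.IsCircuit C ∧ C.ncard = 3 ∧ ¬ C ⊆ Sn}.ncard * (p + d - 3) ≤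
              (t - (t - o)) * (p + d - 3) := Nat.mul_le_mul_right _ (by omega)
          omega
        · exact Nat.zero_le _
      rcases hcase with ⟨h𝒯'r, hout⟩ | ⟨h𝒯'r, hall⟩
      · -- (A) the chain of `r` triangles
        have hout0 : {C : Set α | N.IsCircuit C ∧ C.ncard = 3 ∧ ¬ C ⊆ Sn}.ncard + r ≤ t := hout
        have hout' : {C : Set α | N.IsCircuit C ∧ C.ncard = 3 ∧ ¬ C ⊆ Sn}.ncard ≤ t - r := by omega
        have hX := hXgen (t - r) (by omega) hout'
        have htr : t - (t - r) = r := by omega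
        rw [htr] at hX
        have huI : u ∈ Finset.Icc 3 (3 * r) := Finset.mem_Icc.2 ⟨hSn3, by omega⟩
        refine hline 𝒯' h𝒯'tri u hu' Sn hSnE r k _ hSnν (by omega) hX _ 𝒵 h𝒵 hZc ?_
        rw [h𝒯'r]
        have := hokA t htI u huI
        rwa [← hmu] at this
      · -- (B) every triangle inside `Sn`
        have hout0 : {C : Set α | N.IsCircuit C ∧ C.ncard = 3 ∧ ¬ C ⊆ Sn}.ncard ≤ 0 := by
          have hempty : {C : Set α | N.IsCircuit C ∧ C.ncard = 3 ∧ ¬ C ⊆ Sn} = ∅ := by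
            ext C
            simp only [Set.mem_setOf_eq, Set.mem_empty_iff_false, iff_false]
            rintro ⟨h1, h2, h3⟩
            exact h3 (hall C h1 h2)
          rw [hempty, Set.ncard_empty]
        have hX := hXgen 0 (Nat.zero_le _) hout0
        rw [Nat.sub_zero] at hX
        have hiI : 𝒯'.card ∈ Finset.Icc 1 (r - 1) := Finset.mem_Icc.2 ⟨Finset.card_pos.2 hne, by omega⟩
        have huI : u ∈ Finset.Icc 3 (3 * 𝒯'.card) := Finset.mem_Icc.2 ⟨hSn3, hu3r⟩
        -- the pruning: `t ≤ cq3 ν(Sn) ≤ cq3 (u − 2)`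
        have hprune : t ≤ TriangleCap.cq3 (u - 2) := by
          obtain ⟨ν, hν⟩ := exists_nullity N hSnE
          have h1 : {C : Set α | N.IsCircuit C ∧ C.ncard = 3}.ncard ≤ TriangleCap.cq3 ν :=
            ncard_triangles_le_cq3_of_subset N hNfree hSnE hall hν
          obtain ⟨C, hC⟩ := hne
          have h2 : (2 : ℕ∞) ≤ N.eRk Sn :=
            two_le_eRk_of_triangle_subset N hNfree (h𝒯'tri C hC).1 (h𝒯'tri C hC).2 (hsubS C hC)
          have hrk : N.eRk Sn ≠ ⊤ := ((N.eRk_le_encard Sn).trans_lt hSnfin.encard_lt_top).ne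
          obtain ⟨rS, hrS⟩ := ENat.ne_top_iff_exists.1 hrk
          rw [← hrS] at h2 hν
          rw [← hSnfin.cast_ncard_eq] at hν
          have h2' : 2 ≤ rS := by exact_mod_cast h2
          have hν' : Sn.ncard = rS + ν := by exact_mod_cast hν
          have hν2 : ν ≤ u - 2 := by omega
          exact h1.trans (cq3_mono hν2)
        refine hline 𝒯' h𝒯'tri u hu' Sn hSnE r k _ hSnν (by omega) hX _ 𝒵 h𝒵 hZc ?_
        have := hokB t htI 𝒯'.card hiI u huI hprune
        rwa [← hmu] at this
  rw [ThmN.RLS_iff, hNtop]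
  rw [hn] at hNmid
  have hmidQ : ((Matroid.midCount N p 4 : ℕ) : ℚ) + ((∑ j ∈ Finset.range c, 2 ^ (n - 1 - j) : ℕ) : ℚ) ≤
      ((Matroid.midCount M (p + c) 4 : ℕ) : ℚ) + ((∑ j ∈ Finset.range c, w3plus (n - 1 - j) : ℕ) : ℚ) := by
    exact_mod_cast hNmid
  linarith

end S1

end PercRepro
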